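import Literature.MathematicalPhysics.QuantumFieldTheory.OSEnvelopeBases
import Mathlib.Analysis.SpecialFunctions.Complex.Arg
import HarnessLib

/-!
# Blocks and placements for the OS II continuation regions (bookkeeping for (A_N)/(P_N))

Topic `Literature/MathematicalPhysics/QuantumFieldTheory`; support file (all proved; small
definitions, no named facts) for the discharge of (A1) `OS1975_exists_timeContinuation`.
Osterwalder–Schrader II (Comm. Math. Phys. 42 (1975)), Ch. V.2, (5.16)–(5.17), (5.23): the
continued Schwinger function `S_k` at the generating points is
`S_k(θζ', x' + x + τ, ζ) = (Ψₙ(x', ζ'), e^{-τH} Ψₘ(x, ζ))`, `k = n + m - 1`; the vector of the `k`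
arguments is the **placement** `(ζ'_{n-2}, …, ζ'_0, ·, ζ_0, …, ζ_{m-2})` (first block reversed and
conjugated). This file fixes the index conventions once, matching `splitLeft`/`splitRight`/`dEmbed`
of `OSEnvelopeBases`:

* `blockRevLeft Z p = (Z_{p-1}, …, Z_0)`, `blockRight Z p = (Z_{p+1}, …, Z_{k-1})` (any type), with
  `splitLeft v p = -blockRevLeft v p`, `splitRight v p = blockRight v p`;
* `cPlace w t z = (w_{m₁-1}, …, w_0, t, z_0, …, z_{m₂-1}) : Fin (m₁ + 1 + m₂) → α` and its blocks,
  `cPlace_map`, `dEmbed u = cPlace (-u) 0 u`, the reconstruction `cPlace_blocks`;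
* the transport lemma `apply_finCast` for families `S k : (Fin k → α) → β` along `a = b`;
* arguments: `arg (conj z) = -arg z` for `Re z > 0`, the argument vectors of the conjugated left
  block and of the right block are `splitLeft`/`splitRight` of the argument vector, and the
  consequent memberships of the blocks of a point of a generating piece
  (`star_blockRevLeft_mem_argRegion`, `blockRight_mem_argRegion`).

## References

* K. Osterwalder, R. Schrader, *Axioms for Euclidean Green's functions II*, Comm. Math. Phys. 42
  (1975) 281–305, Ch. V.2 (5.16)–(5.17), (5.23)–(5.24). [OsterwalderSchraderCMP1975]
-/

noncomputable section

open Set Complex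
open scoped ComplexConjugate

namespace Literature.MathematicalPhysics.QuantumFieldTheory.OSEnvelope

/-! ### Blocks -/

section Blocks

variable {α : Type*} {k : ℕ}

/-- **The reversed left block** `(Z_{p-1}, …, Z_0)` of `Z` at the split position `p`. [cite: OsterwalderSchraderCMP1975, Ch. V.2 eq. (5.23)] -/
def blockRevLeft (Z : Fin k → α) (p : Fin k) : Fin p → α :=
  fun i => Z ⟨p - 1 - i, by have := p.2; omega⟩

/-- **The right block** `(Z_{p+1}, …, Z_{k-1})` of `Z` at the split position `p`. [cite: OsterwalderSchraderCMP1975, Ch. V.2 eq. (5.23)] -/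
def blockRight (Z : Fin k → α) (p : Fin k) : Fin (k - 1 - p) → α :=
  fun i => Z ⟨p + 1 + i, by have := i.2; omega⟩

/-- Entries of the reversed left block. [folklore] -/
@[simp] theorem blockRevLeft_apply (Z : Fin k → α) (p : Fin k) (i : Fin p) :
    blockRevLeft Z p i = Z ⟨p - 1 - i, by have := p.2; omega⟩ := rfl

/-- Entries of the right block. [folklore] -/
@[simp] theorem blockRight_apply (Z : Fin k → α) (p : Fin k) (i : Fin (k - 1 - p)) :
    blockRight Z p i = Z ⟨p + 1 + i, by have := i.2; omega⟩ := rfl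

/-- Blocks commute with maps of the entries. [folklore] -/
theorem blockRevLeft_map {β : Type*} (f : α → β) (Z : Fin k → α) (p : Fin k) :
    blockRevLeft (fun i => f (Z i)) p = fun i => f (blockRevLeft Z p i) := rfl

/-- Blocks commute with maps of the entries. [folklore] -/
theorem blockRight_map {β : Type*} (f : α → β) (Z : Fin k → α) (p : Fin k) :
    blockRight (fun i => f (Z i)) p = fun i => f (blockRight Z p i) := rfl

/-- `splitLeft` is the negated reversed left block. [folklore] -/
theorem splitLeft_eq_neg_blockRevLeft (v : Fin k → ℝ) (p : Fin k) :
    splitLeft v p = -blockRevLeft v p := rfl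

/-- `splitRight` is the right block. [folklore] -/
theorem splitRight_eq_blockRight (v : Fin k → ℝ) (p : Fin k) : splitRight v p = blockRight v p := rfl

end Blocks

/-! ### Placements -/

section Place

variable {α : Type*} {m₁ m₂ : ℕ}

/-- **The placement** `cPlace w t z = (w_{m₁-1}, …, w_0, t, z_0, …, z_{m₂-1})` of two blocks around a
middle slot (the first block reversed; with `w = ζ̄'`, OS II's `(θζ', t, ζ)`). [cite: OsterwalderSchraderCMP1975, Ch. V.2 eqs. (5.16)–(5.17)] -/
def cPlace (w : Fin m₁ → α) (t : α) (z : Fin m₂ → α) : Fin (m₁ + 1 + m₂) → α :=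
  fun i => if h : (i : ℕ) < m₁ then w ⟨m₁ - 1 - i, by omega⟩
    else if h' : (i : ℕ) = m₁ then t else z ⟨i - m₁ - 1, by have := i.2; omega⟩

/-- Left block entries. [folklore] -/
theorem cPlace_apply_lt (w : Fin m₁ → α) (t : α) (z : Fin m₂ → α) {i : Fin (m₁ + 1 + m₂)}
    (h : (i : ℕ) < m₁) : cPlace w t z i = w ⟨m₁ - 1 - i, by omega⟩ := by
  simp [cPlace, h]

/-- Middle entry. [folklore] -/
theorem cPlace_apply_mid (w : Fin m₁ → α) (t : α) (z : Fin m₂ → α) {i : Fin (m₁ + 1 + m₂)}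
    (h : (i : ℕ) = m₁) : cPlace w t z i = t := by
  simp [cPlace, h]

/-- Right block entries. [folklore] -/
theorem cPlace_apply_gt (w : Fin m₁ → α) (t : α) (z : Fin m₂ → α) {i : Fin (m₁ + 1 + m₂)}
    (h : m₁ < (i : ℕ)) : cPlace w t z i = z ⟨i - m₁ - 1, by have := i.2; omega⟩ := by
  have h1 : ¬ (i : ℕ) < m₁ := by omega
  have h2 : ¬ (i : ℕ) = m₁ := by omega
  simp [cPlace, h1, h2]

/-- Placements commute with maps of the entries. [folklore] -/
theorem cPlace_map {β : Type*} (f : α → β) (w : Fin m₁ → α) (t : α) (z : Fin m₂ → α) :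
    (fun i => f (cPlace w t z i)) = cPlace (fun i => f (w i)) (f t) (fun i => f (z i)) := by
  funext i
  simp only [cPlace]
  split_ifs <;> rfl

/-- The middle position as an element of `Fin (m₁ + 1 + m₂)`. [folklore] -/
def midPos (m₁ m₂ : ℕ) : Fin (m₁ + 1 + m₂) := ⟨m₁, by omega⟩

/-- The value of the middle position. [folklore] -/
@[simp] theorem midPos_val (m₁ m₂ : ℕ) : ((midPos m₁ m₂ : Fin (m₁ + 1 + m₂)) : ℕ) = m₁ := rfl

/-- The reversed left block of a placement is the first block. [folklore] -/
theorem blockRevLeft_cPlace (w : Fin m₁ → α) (t : α) (z : Fin m₂ → α) :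
    blockRevLeft (cPlace w t z) (midPos m₁ m₂) = w := by
  funext i
  rw [blockRevLeft_apply, cPlace_apply_lt _ _ _ (by simp; omega)]
  congr 1
  ext
  simp
  omega

/-- The middle entry of a placement. [folklore] -/
theorem cPlace_midPos (w : Fin m₁ → α) (t : α) (z : Fin m₂ → α) :
    cPlace w t z (midPos m₁ m₂) = t := cPlace_apply_mid _ _ _ rfl

/-- The right block of a placement is the last block (entrywise, along the index identification
`m₁ + 1 + m₂ - 1 - m₁ = m₂`). [folklore] -/
theorem blockRight_cPlace (w : Fin m₁ → α) (t : α) (z : Fin m₂ → α)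
    (i : Fin (m₁ + 1 + m₂ - 1 - (midPos m₁ m₂ : ℕ))) :
    blockRight (cPlace w t z) (midPos m₁ m₂) i = z ⟨i, by have := i.2; simp at this; omega⟩ := by
  rw [blockRight_apply, cPlace_apply_gt _ _ _ (by simp; omega)]
  congr 1
  ext
  simp
  omega

/-- **Reconstruction**: a vector is the placement of its blocks around any position. [folklore] -/
theorem cPlace_blocks {k : ℕ} (Z : Fin k → α) (p : Fin k) (i : Fin k) :
    cPlace (blockRevLeft Z p) (Z p) (blockRight Z p) ⟨i, by omega⟩ = Z i := by
  rcases lt_trichotomy (i : ℕ) p with h | h | h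
  · rw [cPlace_apply_lt _ _ _ (by exact h), blockRevLeft_apply]
    congr 1; ext; simp; omega
  · rw [cPlace_apply_mid _ _ _ (by exact h)]
    congr 1; exact (Fin.ext h).symm
  · rw [cPlace_apply_gt _ _ _ (by exact h), blockRight_apply]
    congr 1; ext; simp; omega

/-- `dEmbed u = cPlace (-u) 0 u` ((5.24) as a placement). [cite: OsterwalderSchraderCMP1975, Ch. V.2 eq. (5.24)] -/
theorem dEmbed_eq_cPlace {j : ℕ} (u : Fin j → ℝ) : dEmbed u = cPlace (fun i => -u i) 0 u := by
  funext i
  simp only [dEmbed, cPlace]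

/-- **Transport along an index identity**: for a family `S k` of functions of `k` variables and
`a = b`, `S b Z = S a (Z ∘ Fin.cast)`. [folklore] -/
theorem apply_finCast {β : Sort*} (S : (n : ℕ) → (Fin n → α) → β) {a b : ℕ} (h : a = b)
    (Z : Fin b → α) : S b Z = S a (fun i => Z (Fin.cast h i)) := by
  subst h; rfl

end Place

/-! ### Arguments of the blocks -/

section Args

variable {k : ℕ}

/-- `arg (conj z) = -arg z` on the open right half-plane. [folklore] -/
theorem arg_conj_of_re_pos {z : ℂ} (hz : 0 < z.re) : (conj z).arg = -z.arg := by
  rw [Complex.arg_conj]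
  have : z.arg ≠ Real.pi := fun h => by
    have := Complex.arg_eq_pi_iff.1 h
    linarith [this.1]
  simp [this]

/-- **The arguments of the conjugated reversed left block are `splitLeft` of the arguments.** [folklore] -/
theorem arg_star_blockRevLeft {Z : Fin k → ℂ} (hZ : ∀ i, 0 < (Z i).re) (p : Fin k) :
    (fun i => ((star (blockRevLeft Z p)) i).arg) = splitLeft (fun i => (Z i).arg) p := by
  funext i
  simp only [Pi.star_apply, Complex.star_def, blockRevLeft_apply, splitLeft]
  exact arg_conj_of_re_pos (hZ _)

/-- The arguments of the right block are `splitRight` of the arguments. [folklore] -/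
theorem arg_blockRight (Z : Fin k → ℂ) (p : Fin k) :
    (fun i => (blockRight Z p i).arg) = splitRight (fun i => (Z i).arg) p := rfl

/-- The conjugated reversed left block has positive real parts. [folklore] -/
theorem re_star_blockRevLeft_pos {Z : Fin k → ℂ} (hZ : ∀ i, 0 < (Z i).re) (p : Fin k) (i : Fin p) :
    0 < ((star (blockRevLeft Z p)) i).re := by
  simp only [Pi.star_apply, Complex.star_def, blockRevLeft_apply, Complex.conj_re]
  exact hZ _

/-- The right block has positive real parts. [folklore] -/
theorem re_blockRight_pos {Z : Fin k → ℂ} (hZ : ∀ i, 0 < (Z i).re) (p : Fin k) (i : Fin (k - 1 - p)) :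
    0 < (blockRight Z p i).re := hZ _

/-- **Blocks of a point of a generating piece**, left: if `Re Zᵢ > 0` and the argument vector of `Z`
has `splitLeft` in `D p`, then the conjugated reversed left block lies in the argument region of
`D p`. [cite: OsterwalderSchraderCMP1975, Ch. V.2 eq. (5.23)] -/
theorem star_blockRevLeft_mem_argRegion {D : (j : ℕ) → Set (Fin j → ℝ)} {Z : Fin k → ℂ}
    (hZ : ∀ i, 0 < (Z i).re) (p : Fin k) (hL : splitLeft (fun i => (Z i).arg) p ∈ D p) :
    star (blockRevLeft Z p) ∈
      {W : Fin p → ℂ | (∀ i, 0 < (W i).re) ∧ (fun i => (W i).arg) ∈ D p} :=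
  ⟨re_star_blockRevLeft_pos hZ p, by rw [arg_star_blockRevLeft hZ p]; exact hL⟩

/-- **Blocks of a point of a generating piece**, right. [cite: OsterwalderSchraderCMP1975, Ch. V.2 eq. (5.23)] -/
theorem blockRight_mem_argRegion {D : (j : ℕ) → Set (Fin j → ℝ)} {Z : Fin k → ℂ}
    (hZ : ∀ i, 0 < (Z i).re) (p : Fin k) (hR : splitRight (fun i => (Z i).arg) p ∈ D (k - 1 - p)) :
    blockRight Z p ∈
      {W : Fin (k - 1 - p) → ℂ | (∀ i, 0 < (W i).re) ∧ (fun i => (W i).arg) ∈ D (k - 1 - p)} :=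
  ⟨re_blockRight_pos hZ p, by rw [arg_blockRight]; exact hR⟩

/-- **Arguments of a placement are dominated entrywise**: if `|arg wᵢ| ≤ φ_{i}`, `t > 0` and
`|arg zⱼ| ≤ ψⱼ` then `|arg (cPlace w t z)ᵢ| ≤ |(cPlace φ 0 ψ)ᵢ|` — the input of the solidity of
the bases (`osBaseC_solid`). [folklore] -/
theorem abs_arg_cPlace_le {m₁ m₂ : ℕ} {w : Fin m₁ → ℂ} {z : Fin m₂ → ℂ} {t : ℝ} (ht : 0 < t)
    {φ : Fin m₁ → ℝ} {ψ : Fin m₂ → ℝ} (hw : ∀ i, |(w i).arg| ≤ φ i) (hz : ∀ j, |(z j).arg| ≤ ψ j)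
    (i : Fin (m₁ + 1 + m₂)) : |(cPlace w (t : ℂ) z i).arg| ≤ |cPlace φ 0 ψ i| := by
  rcases lt_trichotomy (i : ℕ) m₁ with h | h | h
  · rw [cPlace_apply_lt _ _ _ h, cPlace_apply_lt _ _ _ h]
    exact (hw _).trans (le_abs_self _)
  · rw [cPlace_apply_mid _ _ _ h, cPlace_apply_mid _ _ _ h, Complex.arg_ofReal_of_nonneg ht.le]
  · rw [cPlace_apply_gt _ _ _ h, cPlace_apply_gt _ _ _ h]
    exact (hz _).trans (le_abs_self _)

/-- All entries of a placement have positive real part when those of the blocks and the middle do. [folklore] -/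
theorem re_cPlace_pos {m₁ m₂ : ℕ} {w : Fin m₁ → ℂ} {z : Fin m₂ → ℂ} {t : ℂ} (hw : ∀ i, 0 < (w i).re)
    (ht : 0 < t.re) (hz : ∀ j, 0 < (z j).re) (i : Fin (m₁ + 1 + m₂)) : 0 < (cPlace w t z i).re := by
  rcases lt_trichotomy (i : ℕ) m₁ with h | h | h
  · rw [cPlace_apply_lt _ _ _ h]; exact hw _
  · rw [cPlace_apply_mid _ _ _ h]; exact ht
  · rw [cPlace_apply_gt _ _ _ h]; exact hz _

end Args

end Literature.MathematicalPhysics.QuantumFieldTheory.OSEnvelope
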